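/-
Copyright (c) 2026 the pub-hodgecm-mathlib formalisation cell (harness21).  Prover seat hodgecm-mathlib-LH4-p06 (g0): unit U2H_HSide of the «(D-RAM) FOUR-FRAME» road,
TIER-2 brick «E» (depth of the canonical roots near `1`) of the row-(1) matching lemma behind `stub_U2H_hSideAnchorRows_unit0`.  2026-09-03.
-/
import Literature.NumberTheory.Rogawski1990.FinExplicitTransferFactorDeepTauUniform      -- ★ `eventually_nhds_one_valued_sub_one_le`, brings ★ `continuous_fst_localMatrix`, `continuous_finGammaTwo`
import Literature.NumberTheory.Rogawski1990.FinExplicitTransferFactorDeepTauAnyPlace     -- ★ `toPlace_heckeUniformizer_ne_zero`, `valued_toPlace_heckeUniformizer_pow_lt_one`, `two_ne_zero_adicCompletion`, `valued_two_le_one`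
import Summits.HodgeConjecture.HodgeConjecture.Theorems.F0P3cDyRamCayleySignFPartProd    -- ★ p855070: `valued_eq_one_of_mul_map_eq_one`
import HarnessLib

/-!
# Crux `H413`, line LH4 «(D-RAM) FOUR-FRAME» road — unit U2H_HSide (ii-H), TIER 2, brick «E»: NEAR `1 ∈ H_v` THE CANONICAL ROOTS ARE DEEP,
# `|a − 1|_w² < |8|_w` for every canonical root `a` of an eigenvalue `z a²` of `g_w` (every non-split place, dyadic included)

Cell `hodgecm-mathlib` (D-0151), FLOOR 0, crux item H413 = `stmt-HodgeConjecture-24833`, route of record `HCCMUnconditional`; squad F0∕P3c∕LH4; tier-1 module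
`Cruxes/H413/Lines/F0_P3c_DyRamFourFrame_U2H_HSide.lean`, export `stub_U2H_hSideAnchorRows_unit0` (seat LH4-p06 (g0)).  THEOREMS ONLY (no `def`, no instance, no notation, no
`sorry`, no named fact, default heartbeats); lane `--supports stmt-HodgeConjecture-24833` (count-neutral).

WHAT THIS BRICK DOES.  Bricks «Δ1»∕«Δ2» (★ `F0P3cDyRamRowOneDeltaBaseValue`) and (c′)(c″) (★ `F0P3cDyRamCayleySignFPartProd`) ask the canonical roots `a, b` of (D-H) row (1) to be
DEEP, `|a − 1|_w², |b − 1|_w² < |8|_w`, where the row only carries `|a − 1|_w < |2|_w` (`_ha1`) — the remaining depth must come from `γ_H ∈ V`, `V ∈ 𝓝 1` small.  Here: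
(§1) a root `r` of the characteristic polynomial of a `2 × 2` matrix satisfies `(r − 1)² = (tr − 2)·r − (det − 1)` (Cayley–Hamilton in degree 2), so `|r − 1|² ≤ max(|tr − 2|·|r|, |det − 1|)`;
(§2) `γ_H ↦ tr g_w` is continuous and `= 2` at `γ_H = 1` (twin of ★ `eventually_nhds_one_valued_sub_one_le` for `u_w`, `det g_w`), so EVENTUALLY near `1` all of `|tr g_w − 2|, |det g_w − 1|,
|u_w − 1| ≤ |c|` for any `c ≠ 0`; (§3, HEAD) with `c := 32·ι_w ϖ_v`: for norm-one `a, z` with `|a − 1| < |2|`, `z = u_w` and `z a²` a root of `χ_{g_w}`: `|a² − 1| ≤ max(|z a² − 1|, |z − 1|)`,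
`|a − 1|·|2| = |a² − 1|` (`|a + 1| = |2|`), hence `|a − 1|² · |4| = |a² − 1|² < |32|`, i.e. **`|a − 1|_w² < |8|_w`**.

* §1 `sub_one_sq_eq_of_isRoot_charpoly` (`(r − 1)² = (tr M − 2)·r − (det M − 1)`), `valued_sub_one_sq_le_of_isRoot_charpoly`.
* §2 `eventually_nhds_one_valued_trace_sub_two_le` (trace twin of ★).
* §3 HEAD **`eventually_nhds_one_forall_canonicalRoot_deep`**.

HONEST LABEL.  Count-neutral; nothing printed is asserted; `HC_CM` is proved only modulo the 7 printed citations (2 remaining: hLiu418 = `stmt-HodgeConjecture-24832`, h413 =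
`stmt-HodgeConjecture-24833`) until rung 0 closes.

## References
* [Rogawski1990] J. D. Rogawski, *Automorphic Representations of Unitary Groups in Three Variables*, Ann. of Math. Stud. 123 (1990): §4.9 p. 55, Prop. 8.1.3 p. 116 («for `t`
  sufficiently close to `1`»).
* [Serre1979] J.-P. Serre, *Local Fields*, GTM 67 (1979): Ch. II §1 (valuation balls are neighbourhoods).
* [HornJohnson2013] R. A. Horn, C. R. Johnson, *Matrix Analysis* (2nd ed., 2013): 2.4.P16 (eigenvalues of a `2 × 2` matrix from trace and determinant).
-/

set_option autoImplicit false

noncomputable section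

namespace Summit.HodgeConjecture.HodgeConjecture.Cruxes.H413.F0P3cDyRamRowOneRootDepth

open NumberField IsDedekindDomain Filter Topology Polynomial
open Literature.NumberTheory.Automorphic Literature.NumberTheory.Automorphic.UnitaryGroup Literature.NumberTheory.GaloisRepresentations
open Literature.NumberTheory.Rogawski1990
open Summit.HodgeConjecture.HodgeConjecture.Cruxes.H413.F0P3cDyRamCayleySignFPartProd
open scoped Valued WithZero Matrix MatrixGroups

/-! ## §1 Cayley–Hamilton in degree 2, read at a root -/

section Algebra

variable {K : Type} [Field K]

/-- **`(r − 1)² = (tr M − 2)·r − (det M − 1)`** for a root `r` of the characteristic polynomial of a `2 × 2` matrix (`χ_M = X² − tr·X + det`, Mathlib `Matrix.charpoly_fin_two`).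
[cite: HornJohnson2013, 2.4.P16] -/
theorem sub_one_sq_eq_of_isRoot_charpoly (M : Matrix (Fin 2) (Fin 2) K) {r : K} (hr : M.charpoly.IsRoot r) :
    (r - 1) * (r - 1) = (M.trace - 2) * r - (M.det - 1) := by
  rw [Matrix.charpoly_fin_two, IsRoot.def] at hr
  simp only [eval_add, eval_sub, eval_pow, eval_X, eval_mul, eval_C] at hr
  linear_combination hr

variable [Valued K ℤᵐ⁰]

/-- **`|r − 1|² ≤ max(|tr M − 2|, |det M − 1|)`** for a root `r` with `|r| = 1` of the characteristic polynomial of a `2 × 2` matrix. [cite: HornJohnson2013, 2.4.P16] [cite: Serre1979, Ch. II §1] -/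
theorem valued_sub_one_sq_le_of_isRoot_charpoly (M : Matrix (Fin 2) (Fin 2) K) {r : K} (hr : M.charpoly.IsRoot r) (hvr : Valued.v r = 1) :
    Valued.v (r - 1) * Valued.v (r - 1) ≤ max (Valued.v (M.trace - 2)) (Valued.v (M.det - 1)) := by
  rw [← map_mul, sub_one_sq_eq_of_isRoot_charpoly M hr]
  refine le_trans (Valuation.map_sub _ _ _) (max_le_max ?_ le_rfl)
  rw [map_mul, hvr, mul_one]

end Algebra

/-! ## §2 The trace is continuous and `= 2` at `γ_H = 1` -/

section Trace

variable (L : Type) [Field L] [NumberField L] [IsCMField L] (v : HeightOneSpectrum (𝓞 ↥(maximalRealSubfield L)))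
  (w : PlacesOver L v)

omit [IsCMField L] in
/-- The valuation ball `{x | |x − c₀|… }`: `{x | |x − 2|_w ≤ |c|_w}` (`c ≠ 0`) is a neighbourhood of `2` in `L_w`. [cite: Serre1979, Ch. II §1] -/
theorem setOf_valued_sub_le_mem_nhds {c : w.1.adicCompletion L} (hc : c ≠ 0) (x₀ : w.1.adicCompletion L) :
    {x : w.1.adicCompletion L | Valued.v (x - x₀) ≤ Valued.v c} ∈ 𝓝 x₀ := by
  refine Filter.mem_of_superset (Metric.closedBall_mem_nhds x₀ (norm_pos_iff.2 hc)) fun x hx => ?_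
  rw [Metric.mem_closedBall, dist_eq_norm] at hx
  exact Valued.toNormedField.norm_le_iff.1 hx

/-- **Eventually near `1 ∈ H_v`: `|tr g_w − 2|_w ≤ |c|_w`** (`c ≠ 0`): `γ_H ↦ tr g_w` is continuous (★ `continuous_fst_localMatrix`) and equals `2` at `γ_H = 1`.
[cite: Rogawski1990, §4.9 p. 55; Prop. 8.1.3 p. 116] -/
theorem eventually_nhds_one_valued_trace_sub_two_le {c : w.1.adicCompletion L} (hc : c ≠ 0) :
    ∀ᶠ γH : (cmDatum L 2 (Matrix.of fun i j : Fin 2 => if i.val + j.val + 1 = 2 then (1 : L) else 0)).Local v ×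
        (cmDatum L 1 (Matrix.of fun i j : Fin 1 => if i.val + j.val + 1 = 1 then (1 : L) else 0)).Local v in 𝓝 1,
      Valued.v (((γH.1.val.val : Matrix (Fin 2) (Fin 2) (LocalRing L v)).map
          (Pi.evalRingHom (fun w' : PlacesOver L v => w'.1.adicCompletion L) w)).trace - 2) ≤ Valued.v c := by
  have hct : Continuous fun γH : (cmDatum L 2 (Matrix.of fun i j : Fin 2 => if i.val + j.val + 1 = 2 then (1 : L) else 0)).Local v ×
        (cmDatum L 1 (Matrix.of fun i j : Fin 1 => if i.val + j.val + 1 = 1 then (1 : L) else 0)).Local v =>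
      (((γH.1.val.val : Matrix (Fin 2) (Fin 2) (LocalRing L v)).map
        (Pi.evalRingHom (fun w' : PlacesOver L v => w'.1.adicCompletion L) w)).trace) :=
    ((continuous_fst_localMatrix L v).matrix_map (continuous_apply w)).matrix_trace
  have ht1 : (((1 : (cmDatum L 2 (Matrix.of fun i j : Fin 2 => if i.val + j.val + 1 = 2 then (1 : L) else 0)).Local v ×
        (cmDatum L 1 (Matrix.of fun i j : Fin 1 => if i.val + j.val + 1 = 1 then (1 : L) else 0)).Local v).1.val.val :
          Matrix (Fin 2) (Fin 2) (LocalRing L v)).map (Pi.evalRingHom (fun w' : PlacesOver L v => w'.1.adicCompletion L) w)).trace = 2 := by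
    change ((1 : Matrix (Fin 2) (Fin 2) (LocalRing L v)).map (Pi.evalRingHom (fun w' : PlacesOver L v => w'.1.adicCompletion L) w)).trace = 2
    rw [Matrix.map_one _ (map_zero _) (map_one _), Matrix.trace_one, Fintype.card_fin]
    norm_num
  have hball := setOf_valued_sub_le_mem_nhds L v w hc (2 : w.1.adicCompletion L)
  exact hct.continuousAt.preimage_mem_nhds (by rw [ht1]; exact hball)

end Trace

/-! ## §3 HEAD: near `1`, canonical roots are deep -/

section Head

variable (L : Type) [Field L] [NumberField L] [IsCMField L] (v : HeightOneSpectrum (𝓞 ↥(maximalRealSubfield L)))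
  (w : PlacesOver L v) (hw : IsCMField.complexConj L • w.1 = w.1)

include hw in
/-- **HEAD «E» — NEAR `1 ∈ H_v` THE CANONICAL ROOTS ARE DEEP.**  There is `V ∈ 𝓝 (1 : H_v)` such that for every `γ_H ∈ V`, every norm-one `z = γ₂(γ_H)_w` and every norm-one
CANONICAL ROOT `a` (`|a − 1|_w < |2|_w`) with `z·a·a` a root of `χ_{g_w}` (the (D-H) row-(1) binders `_ha, _hz, _hzγ, _hra, _ha1`): **`|a − 1|_w · |a − 1|_w < |8|_w`** — the depth
asked by ★ (c′)(c″)∕«Δ1»∕«Δ2».  (Symmetric in `a ↔ b`: apply twice.)  `V` = «`|tr g_w − 2|, |det g_w − 1|, |u_w − 1| ≤ |32·ι_w ϖ_v|`» (§2 + ★ `eventually_nhds_one_valued_sub_one_le`).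
[cite: Rogawski1990, §4.9 p. 55; Prop. 8.1.3 p. 116] [cite: Serre1979, Ch. II §1] [cite: HornJohnson2013, 2.4.P16] -/
theorem eventually_nhds_one_forall_canonicalRoot_deep :
    ∃ V ∈ 𝓝 (1 : (cmDatum L 2 (Matrix.of fun i j : Fin 2 => if i.val + j.val + 1 = 2 then (1 : L) else 0)).Local v ×
        (cmDatum L 1 (Matrix.of fun i j : Fin 1 => if i.val + j.val + 1 = 1 then (1 : L) else 0)).Local v),
      ∀ γH ∈ V, ∀ (a z : w.1.adicCompletion L),
        a * galAdicCompletionMap (L := L) (IsCMField.complexConj L) hw a = 1 → z * galAdicCompletionMap (L := L) (IsCMField.complexConj L) hw z = 1 →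
        Valued.v (a - 1) < Valued.v (2 : w.1.adicCompletion L) →
        z = finGammaTwo L v γH w →
        ((((γH).1.val : GL (Fin 2) (UnitaryGroup.LocalRing L v)).val.map
          (Pi.evalRingHom (fun w' : UnitaryGroup.PlacesOver L v => w'.1.adicCompletion L) w))).charpoly.IsRoot (z * (a * a)) →
        Valued.v (a - 1) * Valued.v (a - 1) < Valued.v (8 : w.1.adicCompletion L) := by
  -- the small constant `c = 32 · ι_w ϖ_v`
  set ϖF : w.1.adicCompletion L :=
    toPlace v w (HeckeCharacter.uniformizer ↥(maximalRealSubfield L) v : v.adicCompletion ↥(maximalRealSubfield L)) with hϖFdef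
  have h20 : (2 : w.1.adicCompletion L) ≠ 0 := two_ne_zero_adicCompletion L v w
  have hϖF0 : ϖF ≠ 0 := toPlace_heckeUniformizer_ne_zero L v w
  have h32 : (32 : w.1.adicCompletion L) = 2 * 2 * 2 * 2 * 2 := by norm_num
  have h320 : (32 : w.1.adicCompletion L) ≠ 0 := by rw [h32]; exact mul_ne_zero (mul_ne_zero (mul_ne_zero (mul_ne_zero h20 h20) h20) h20) h20
  have hc0 : (32 : w.1.adicCompletion L) * ϖF ^ 1 ≠ 0 := mul_ne_zero h320 (pow_ne_zero _ hϖF0)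
  -- `|c| < |32|` and `|c| ≤ 1`
  have hϖlt : Valued.v (ϖF ^ 1) < 1 := valued_toPlace_heckeUniformizer_pow_lt_one L v w (le_refl 1)
  have hv32 : Valued.v (32 : w.1.adicCompletion L) ≠ 0 := (Valuation.ne_zero_iff _).2 h320
  have h2le : Valued.v (2 : w.1.adicCompletion L) ≤ 1 := valued_two_le_one L v w
  have h32le : Valued.v (32 : w.1.adicCompletion L) ≤ 1 := by
    rw [h32, map_mul, map_mul, map_mul, map_mul]
    exact mul_le_one' (mul_le_one' (mul_le_one' (mul_le_one' h2le h2le) h2le) h2le) h2le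
  have hclt : Valued.v ((32 : w.1.adicCompletion L) * ϖF ^ 1) < Valued.v (32 : w.1.adicCompletion L) := by
    rw [map_mul]; exact mul_lt_of_lt_one_right (zero_lt_iff.2 hv32) hϖlt
  have hcle1 : Valued.v ((32 : w.1.adicCompletion L) * ϖF ^ 1) ≤ 1 := le_trans hclt.le h32le
  obtain ⟨V₁, hV₁, h₁⟩ := (eventually_nhds_one_valued_sub_one_le L v w hc0).exists_mem
  obtain ⟨V₂, hV₂, h₂⟩ := (eventually_nhds_one_valued_trace_sub_two_le L v w hc0).exists_mem
  refine ⟨V₁ ∩ V₂, Filter.inter_mem hV₁ hV₂, ?_⟩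
  intro γH hγ a z ha hz ha1 hzγ hra
  set σ := galAdicCompletionMap (L := L) (IsCMField.complexConj L) hw with hσdef
  set M := (((γH).1.val : GL (Fin 2) (UnitaryGroup.LocalRing L v)).val.map
    (Pi.evalRingHom (fun w' : UnitaryGroup.PlacesOver L v => w'.1.adicCompletion L) w)) with hMdef
  obtain ⟨hu, hd⟩ := h₁ γH hγ.1
  have ht := h₂ γH hγ.2
  rw [← hzγ] at hu
  have hva : Valued.v a = 1 := valued_eq_one_of_mul_map_eq_one L v w hw ha
  have hvz : Valued.v z = 1 := valued_eq_one_of_mul_map_eq_one L v w hw hz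
  -- the root `r = z a²` has `|r| = 1` and `|r − 1|² ≤ |c|`
  have hvr : Valued.v (z * (a * a)) = 1 := by rw [map_mul, map_mul, hvz, hva, one_mul, one_mul]
  have hr : Valued.v (z * (a * a) - 1) * Valued.v (z * (a * a) - 1) ≤ Valued.v ((32 : w.1.adicCompletion L) * ϖF ^ 1) :=
    le_trans (valued_sub_one_sq_le_of_isRoot_charpoly M hra hvr) (max_le ht hd)
  -- hence `|r − 1| < 1`-scale bounds: `|r − 1|² < |32|`, `|z − 1|² < |32|`
  have hr32 : Valued.v (z * (a * a) - 1) * Valued.v (z * (a * a) - 1) < Valued.v (32 : w.1.adicCompletion L) := lt_of_le_of_lt hr hclt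
  have hz1 : Valued.v (z - 1) ≤ 1 := le_trans hu hcle1
  have hz32 : Valued.v (z - 1) * Valued.v (z - 1) < Valued.v (32 : w.1.adicCompletion L) :=
    lt_of_le_of_lt (le_trans (mul_le_of_le_one_left' hz1) hu) hclt
  -- `|a² − 1| ≤ max(|r − 1|, |z − 1|)` (`a² − 1 = ((r − 1) − (z − 1))·z⁻¹`, `|z| = 1`)
  have hz0 : z ≠ 0 := fun h => by rw [h, zero_mul] at hz; exact zero_ne_one hz
  have haa : a * a - 1 = ((z * (a * a) - 1) - (z - 1)) * z⁻¹ := by field_simp; ring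
  have hvaa : Valued.v (a * a - 1) ≤ max (Valued.v (z * (a * a) - 1)) (Valued.v (z - 1)) := by
    rw [haa, map_mul, map_inv₀, hvz, inv_one, mul_one]
    exact Valuation.map_sub _ _ _
  have haa32 : Valued.v (a * a - 1) * Valued.v (a * a - 1) < Valued.v (32 : w.1.adicCompletion L) := by
    rcases le_max_iff.1 hvaa with h | h
    · exact lt_of_le_of_lt (mul_le_mul' h h) hr32
    · exact lt_of_le_of_lt (mul_le_mul' h h) hz32
  -- `|a + 1| = |2|` (canonical root), so `|a − 1|·|2| = |a² − 1|`
  have hap : Valued.v (a + 1) = Valued.v (2 : w.1.adicCompletion L) := by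
    rw [show a + 1 = (a - 1) + 2 by ring, Valuation.map_add_eq_of_lt_right _ ha1]
  have hfac : Valued.v (a - 1) * Valued.v (2 : w.1.adicCompletion L) = Valued.v (a * a - 1) := by
    rw [← hap, ← map_mul]; congr 1; ring
  -- conclude: `|a − 1|²·|4| = |a² − 1|² < |32| = |8|·|4|`
  have hv20 : 0 < Valued.v (2 : w.1.adicCompletion L) := zero_lt_iff.2 ((Valuation.ne_zero_iff _).2 h20)
  have hkey : (Valued.v (a - 1) * Valued.v (a - 1)) * (Valued.v (2 : w.1.adicCompletion L) * Valued.v (2 : w.1.adicCompletion L)) <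
      Valued.v (8 : w.1.adicCompletion L) * (Valued.v (2 : w.1.adicCompletion L) * Valued.v (2 : w.1.adicCompletion L)) := by
    have h8 : Valued.v (8 : w.1.adicCompletion L) * (Valued.v (2 : w.1.adicCompletion L) * Valued.v (2 : w.1.adicCompletion L)) =
        Valued.v (32 : w.1.adicCompletion L) := by
      rw [← map_mul, ← map_mul]; norm_num
    calc (Valued.v (a - 1) * Valued.v (a - 1)) * (Valued.v (2 : w.1.adicCompletion L) * Valued.v (2 : w.1.adicCompletion L))
        = (Valued.v (a - 1) * Valued.v (2 : w.1.adicCompletion L)) * (Valued.v (a - 1) * Valued.v (2 : w.1.adicCompletion L)) := mul_mul_mul_comm _ _ _ _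
      _ = Valued.v (a * a - 1) * Valued.v (a * a - 1) := by rw [hfac]
      _ < Valued.v (32 : w.1.adicCompletion L) := haa32
      _ = _ := h8.symm
  exact lt_of_mul_lt_mul_right' hkey

end Head

end Summit.HodgeConjecture.HodgeConjecture.Cruxes.H413.F0P3cDyRamRowOneRootDepth

end
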